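import Summits.RiemannHypothesis.RiemannHypothesis.Theorems.RuelleBandExactFirstBandStubLaplaceGeneratingFunction
import Mathlib.Analysis.Complex.LocallyUniformLimit
import Mathlib.Topology.Algebra.InfiniteSum.Real
import HarnessLib

/-!
# Stub `stub_dirichletSide` (line `Sketch`, heat cone): the Dirichlet side of the engine

Registered stub `stub_dirichletSide` and helper lemmas for the engine `stub_expConvexDirichlet_real` of line `Sketch` of the crux `RuelleBand.ExactFirstBand`
(item stmt-RiemannHypothesis-2061), file `RuelleBandExactFirstBandStubExpConvexDirichletReal.lean`.
Pure analysis, no zeta.  For weights `w i > 0` and exponents `l i` (`Re (l i) > 0`,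
`Σ w i e^{-t Re (l i)} < ∞` for `t > 0`), step `δ > 0` and `q_i = e^{-δ l i}`:

* `stub_dirichletSide` / `stub_dirichletSide_dirichlet_hasSum` — for `|z| < 1` the power series
  `Σ_k z^k f((k+3)δ)` of the samples of `f t = Re Σ_i w i e^{-t l i}` sums to
  `Σ_i (w i/2)(q_i³/(1 - z q_i) + q̄_i³/(1 - z q̄_i))` (absolutely convergent double series,
  `HasSum.prod_fiberwise` both ways);
* `stub_dirichletSide_nopole` — no denominator `1 - z q` vanishes in the wedge
  `{|z| < r, Im z > 0}` when `q` is real or `‖q‖⁻¹ ≥ r`;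
* `stub_dirichletSide_tail_differentiableOn` — the tail over `{Re (l i) large}` is holomorphic
  on a big disc (uniformly summable bound, `differentiableOn_tsum_of_summable_norm`).
-/

set_option linter.dupNamespace false

noncomputable section

open Complex MeasureTheory Filter Set
open scoped Topology ComplexConjugate BigOperators

namespace Summit.RiemannHypothesis.RiemannHypothesis.Theorems.RuelleBandExactFirstBand

open Literature.Analysis.OperatorTheory

/-! ### Elementary facts about the terms `w i e^{-t l i}` -/

/-- `‖e^{-t l}‖ = e^{-t Re l}` for real `t`. [folklore] -/
theorem stub_dirichletSide_norm_cexp (t : ℝ) (l : ℂ) :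
    ‖cexp (-((t : ℂ) * l))‖ = Real.exp (-(t * l.re)) := by
  rw [Complex.norm_exp]
  congr 1
  simp [Complex.mul_re]

/-- `e^{-δ l}` raised to the power `n` is `e^{-(n δ) l}`. [folklore] -/
theorem stub_dirichletSide_cexp_pow (δ : ℝ) (l : ℂ) (n : ℕ) :
    cexp (-((δ : ℂ) * l)) ^ n = cexp (-((((n : ℝ) * δ : ℝ) : ℂ) * l)) := by
  rw [← Complex.exp_nat_mul]
  congr 1
  push_cast
  ring

/-- Norm summability of the complex terms from the real summability hypothesis. [folklore] -/
theorem stub_dirichletSide_summable_norm {ι : Type} (w : ι → ℝ) (l : ι → ℂ)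
    (hw : ∀ i, 0 < w i) {t : ℝ}
    (hsum : Summable (fun i => w i * Real.exp (-(t * (l i).re)))) :
    Summable (fun i => ‖((w i : ℝ) : ℂ) * cexp (-((t : ℂ) * l i))‖) := by
  refine hsum.congr fun i => ?_
  rw [norm_mul, Complex.norm_real, Real.norm_of_nonneg (hw i).le,
    stub_dirichletSide_norm_cexp]

/-- The complex Dirichlet series converges absolutely for `t > 0`. [folklore] -/
theorem stub_dirichletSide_summable {ι : Type} (w : ι → ℝ) (l : ι → ℂ)
    (hw : ∀ i, 0 < w i) {t : ℝ}
    (hsum : Summable (fun i => w i * Real.exp (-(t * (l i).re)))) :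
    Summable (fun i => ((w i : ℝ) : ℂ) * cexp (-((t : ℂ) * l i))) :=
  (stub_dirichletSide_summable_norm w l hw hsum).of_norm

/-- The real part of the Dirichlet series, cast back to `ℂ`, is the symmetrised series
`Σ (u_i + ū_i)/2`. [folklore] -/
theorem stub_dirichletSide_ofReal_re_tsum {ι : Type} (u : ι → ℂ) (hu : Summable u) :
    (((∑' i, u i).re : ℝ) : ℂ) = ∑' i, (u i + conj (u i)) / 2 := by
  rw [Complex.re_tsum hu, Complex.ofReal_tsum]
  refine tsum_congr fun i => ?_
  rw [Complex.re_eq_add_conj]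

/-! ### The Dirichlet side: the generating function of the samples `f((k+3)δ)` -/

/-- One term of the Dirichlet-side generating function:
`T i z = (w i/2) (q³/(1 - z q) + q̄³/(1 - z q̄))`, `q = e^{-δ l i}`. [folklore] -/
theorem stub_dirichletSide_row_hasSum {δ : ℝ} (wi : ℝ) (li : ℂ) {z : ℂ}
    (hzq : ‖z * cexp (-((δ : ℂ) * li))‖ < 1) :
    HasSum (fun k : ℕ => z ^ k * (((wi : ℝ) : ℂ) / 2) *
        (cexp (-((δ : ℂ) * li)) ^ (k + 3) + conj (cexp (-((δ : ℂ) * li))) ^ (k + 3)))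
      ((((wi : ℝ) : ℂ) / 2) * (cexp (-((δ : ℂ) * li)) ^ 3 / (1 - z * cexp (-((δ : ℂ) * li))) +
        conj (cexp (-((δ : ℂ) * li))) ^ 3 / (1 - z * conj (cexp (-((δ : ℂ) * li)))))) := by
  set q : ℂ := cexp (-((δ : ℂ) * li)) with hq
  have hzq' : ‖z * conj q‖ < 1 := by
    rwa [norm_mul, Complex.norm_conj, ← norm_mul]
  have h1 := (hasSum_geometric_of_norm_lt_one hzq).mul_left (q ^ 3)
  have h2 := (hasSum_geometric_of_norm_lt_one hzq').mul_left (conj q ^ 3)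
  have h := (h1.add h2).mul_left (((wi : ℝ) : ℂ) / 2)
  refine h.congr_fun fun k => ?_
  simp only [mul_pow]
  ring

/-- Norm bound for the double family: `‖z^k (w/2)(q^{k+3} + q̄^{k+3})‖ ≤ w ‖q‖³ ‖z‖^k` when `‖q‖ ≤ 1`,
`w ≥ 0`. [folklore] -/
theorem stub_dirichletSide_norm_G_le {wi : ℝ} (hwi : 0 ≤ wi) {q z : ℂ} (hq : ‖q‖ ≤ 1)
    (k : ℕ) :
    ‖z ^ k * (((wi : ℝ) : ℂ) / 2) * (q ^ (k + 3) + conj q ^ (k + 3))‖ ≤ wi * ‖q‖ ^ 3 * ‖z‖ ^ k := by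
  have hqk : ‖q‖ ^ (k + 3) ≤ ‖q‖ ^ 3 := by
    calc ‖q‖ ^ (k + 3) = ‖q‖ ^ 3 * ‖q‖ ^ k := by ring
      _ ≤ ‖q‖ ^ 3 * 1 := by gcongr; exact pow_le_one₀ (norm_nonneg _) hq
      _ = ‖q‖ ^ 3 := mul_one _
  have hsum : ‖q ^ (k + 3) + conj q ^ (k + 3)‖ ≤ 2 * ‖q‖ ^ 3 := by
    calc ‖q ^ (k + 3) + conj q ^ (k + 3)‖ ≤ ‖q ^ (k + 3)‖ + ‖conj q ^ (k + 3)‖ := norm_add_le _ _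
      _ = ‖q‖ ^ (k + 3) + ‖q‖ ^ (k + 3) := by rw [norm_pow, norm_pow, Complex.norm_conj]
      _ ≤ ‖q‖ ^ 3 + ‖q‖ ^ 3 := add_le_add hqk hqk
      _ = 2 * ‖q‖ ^ 3 := by ring
  have hw2 : ‖(((wi : ℝ) : ℂ) / 2)‖ = wi / 2 := by
    rw [norm_div, Complex.norm_real, Real.norm_of_nonneg hwi]
    norm_num
  rw [norm_mul, norm_mul, norm_pow, hw2]
  calc ‖z‖ ^ k * (wi / 2) * ‖q ^ (k + 3) + conj q ^ (k + 3)‖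
      ≤ ‖z‖ ^ k * (wi / 2) * (2 * ‖q‖ ^ 3) := by gcongr
    _ = wi * ‖q‖ ^ 3 * ‖z‖ ^ k := by ring

/-- **Dirichlet side.** For `‖z‖ < 1`, `δ > 0`: the family `i ↦ T i z` is summable and
`Σ_k z^k · f((k+3)δ)` sums to `Σ_i T i z`, where `f t = Re Σ_i w i e^{-t l i}`. [folklore] -/
theorem stub_dirichletSide_dirichlet_hasSum {ι : Type} [Countable ι] (w : ι → ℝ) (l : ι → ℂ)
    (hw : ∀ i, 0 < w i) (hl : ∀ i, 0 < (l i).re)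
    (hsum : ∀ t : ℝ, 0 < t → Summable (fun i => w i * Real.exp (-(t * (l i).re))))
    {δ : ℝ} (hδ : 0 < δ) {z : ℂ} (hz : ‖z‖ < 1) :
    Summable (fun i => (((w i : ℝ) : ℂ) / 2) *
        (cexp (-((δ : ℂ) * l i)) ^ 3 / (1 - z * cexp (-((δ : ℂ) * l i))) +
          conj (cexp (-((δ : ℂ) * l i))) ^ 3 / (1 - z * conj (cexp (-((δ : ℂ) * l i)))))) ∧
    HasSum (fun k : ℕ => z ^ k *
        (((∑' i, ((w i : ℝ) : ℂ) * cexp (-(((((k : ℝ) + 3) * δ : ℝ) : ℂ) * l i))).re : ℝ) : ℂ))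
      (∑' i, (((w i : ℝ) : ℂ) / 2) *
        (cexp (-((δ : ℂ) * l i)) ^ 3 / (1 - z * cexp (-((δ : ℂ) * l i))) +
          conj (cexp (-((δ : ℂ) * l i))) ^ 3 / (1 - z * conj (cexp (-((δ : ℂ) * l i)))))) := by
  -- notation
  set q : ι → ℂ := fun i => cexp (-((δ : ℂ) * l i)) with hq
  have hq_norm : ∀ i, ‖q i‖ = Real.exp (-(δ * (l i).re)) := fun i =>
    stub_dirichletSide_norm_cexp δ (l i)
  have hq_le : ∀ i, ‖q i‖ ≤ 1 := fun i => by
    rw [hq_norm, Real.exp_le_one_iff, neg_nonpos]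
    exact (mul_pos hδ (hl i)).le
  -- the double family and its summable majorant
  set G : ι × ℕ → ℂ := fun p => z ^ p.2 * (((w p.1 : ℝ) : ℂ) / 2) *
    (q p.1 ^ (p.2 + 3) + conj (q p.1) ^ (p.2 + 3)) with hG
  set B : ι × ℕ → ℝ := fun p => w p.1 * ‖q p.1‖ ^ 3 * ‖z‖ ^ p.2 with hB
  have hB_nonneg : 0 ≤ B := fun p => by
    simp only [hB]
    exact mul_nonneg (mul_nonneg (hw p.1).le (pow_nonneg (norm_nonneg _) 3)) (pow_nonneg (norm_nonneg _) _)
  have hz0 : 0 ≤ ‖z‖ := norm_nonneg z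
  have hgeom : HasSum (fun k : ℕ => ‖z‖ ^ k) (1 - ‖z‖)⁻¹ := hasSum_geometric_of_lt_one hz0 hz
  have hrow_B : ∀ i, HasSum (fun k : ℕ => B (i, k)) (w i * ‖q i‖ ^ 3 * (1 - ‖z‖)⁻¹) := fun i =>
    hgeom.mul_left (w i * ‖q i‖ ^ 3)
  have hq3 : ∀ i, ‖q i‖ ^ 3 = Real.exp (-(3 * δ * (l i).re)) := fun i => by
    rw [hq_norm, ← Real.exp_nat_mul]
    congr 1
    push_cast
    ring
  have hB_sum : Summable B := by
    rw [summable_prod_of_nonneg hB_nonneg]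
    refine ⟨fun i => (hrow_B i).summable, ?_⟩
    have : (fun i => ∑' k, B (i, k)) = fun i => (w i * Real.exp (-(3 * δ * (l i).re))) * (1 - ‖z‖)⁻¹ := by
      funext i
      rw [(hrow_B i).tsum_eq, hq3]
    rw [this]
    exact (hsum (3 * δ) (by positivity)).mul_right _
  have hG_le : ∀ p, ‖G p‖ ≤ B p := fun p =>
    stub_dirichletSide_norm_G_le (hw p.1).le (hq_le p.1) p.2
  have hG_sum : Summable G := Summable.of_norm_bounded hB_sum hG_le
  -- row sums (fixed `i`): the term `T i z`
  have hzq : ∀ i, ‖z * q i‖ < 1 := fun i => by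
    rw [norm_mul]
    calc ‖z‖ * ‖q i‖ ≤ ‖z‖ * 1 := by gcongr; exact hq_le i
      _ < 1 := by rw [mul_one]; exact hz
  have hrows : ∀ i, HasSum (fun k : ℕ => G (i, k))
      ((((w i : ℝ) : ℂ) / 2) * (q i ^ 3 / (1 - z * q i) + conj (q i) ^ 3 / (1 - z * conj (q i)))) :=
    fun i => stub_dirichletSide_row_hasSum (w i) (l i) (hzq i)
  have hfib₁ := hG_sum.hasSum.prod_fiberwise hrows
  -- column sums (fixed `k`): `z^k · f((k+3)δ)`
  have hcols : ∀ k : ℕ, HasSum (fun i => G (i, k))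
      (z ^ k * (((∑' i, ((w i : ℝ) : ℂ) * cexp (-(((((k : ℝ) + 3) * δ : ℝ) : ℂ) * l i))).re : ℝ) : ℂ)) := by
    intro k
    set u : ι → ℂ := fun i => ((w i : ℝ) : ℂ) * cexp (-(((((k : ℝ) + 3) * δ : ℝ) : ℂ) * l i)) with hu
    have hu_sum : Summable u :=
      stub_dirichletSide_summable w l hw (hsum (((k : ℝ) + 3) * δ) (by positivity))
    have hre : (((∑' i, u i).re : ℝ) : ℂ) = ∑' i, (u i + conj (u i)) / 2 :=
      stub_dirichletSide_ofReal_re_tsum u hu_sum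
    have hu2 : Summable (fun i => (u i + conj (u i)) / 2) := by
      have h1 : Summable (fun i => conj (u i)) := (conjCLE : ℂ ≃L[ℝ] ℂ).summable.2 hu_sum
      simpa only [div_eq_mul_inv] using (hu_sum.add h1).mul_right (2 : ℂ)⁻¹
    have hterm : ∀ i, G (i, k) = z ^ k * ((u i + conj (u i)) / 2) := by
      intro i
      have hpow : q i ^ (k + 3) = cexp (-(((((k : ℝ) + 3) * δ : ℝ) : ℂ) * l i)) := by
        rw [hq]
        dsimp only
        rw [stub_dirichletSide_cexp_pow]
        push_cast
        ring_nf
      show z ^ k * (((w i : ℝ) : ℂ) / 2) * (q i ^ (k + 3) + conj (q i) ^ (k + 3)) = _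
      rw [hu]
      dsimp only
      rw [← hpow, map_mul, Complex.conj_ofReal, map_pow]
      ring
    have := (hu2.hasSum.mul_left (z ^ k)).congr_fun fun i => (hterm i)
    rw [← hre] at this
    exact this
  have hfib₂ : HasSum (fun k : ℕ =>
      z ^ k * (((∑' i, ((w i : ℝ) : ℂ) * cexp (-(((((k : ℝ) + 3) * δ : ℝ) : ℂ) * l i))).re : ℝ) : ℂ))
      (∑' p, G p) := by
    have hswap : HasSum (fun p : ℕ × ι => G (p.2, p.1)) (∑' p, G p) := by
      have := (Equiv.prodComm ℕ ι).hasSum_iff (f := G) (a := ∑' p, G p)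
      exact this.2 hG_sum.hasSum
    exact hswap.prod_fiberwise hcols
  refine ⟨hfib₁.summable, ?_⟩
  rw [hfib₁.tsum_eq]
  exact hfib₂


/-! ### No poles in the wedge, and the holomorphic tail -/

/-- If `‖z‖ < r`, `Im z > 0` and `u` is either real or has `‖u‖⁻¹ ≥ r`, then `1 - z u ≠ 0`. [folklore] -/
theorem stub_dirichletSide_nopole {z u : ℂ} {r : ℝ} (hz : ‖z‖ < r) (hzi : 0 < z.im)
    (hu : u.im = 0 ∨ r ≤ ‖u‖⁻¹) : 1 - z * u ≠ 0 := by
  intro h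
  have hzu : z * u = 1 := (sub_eq_zero.1 h).symm
  have hu0 : u ≠ 0 := by
    rintro rfl
    simp at hzu
  have hz_eq : z = u⁻¹ := eq_inv_of_mul_eq_one_left hzu
  rcases hu with hu | hu
  · have : z.im = 0 := by
      rw [hz_eq, Complex.inv_im, hu]
      simp
    linarith
  · have : ‖z‖ = ‖u‖⁻¹ := by rw [hz_eq, norm_inv]
    linarith

/-- Bound for one fraction of the tail: if `‖z q‖ ≤ 1/2` then `‖q³/(1 - z q)‖ ≤ 2 ‖q‖³`. [folklore] -/
theorem stub_dirichletSide_frac_le {z q : ℂ} (h : ‖z * q‖ ≤ 1 / 2) :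
    ‖q ^ 3 / (1 - z * q)‖ ≤ 2 * ‖q‖ ^ 3 := by
  have hden : 1 / 2 ≤ ‖1 - z * q‖ := by
    have := norm_sub_norm_le (1 : ℂ) (z * q)
    rw [norm_one] at this
    linarith
  have hden_pos : 0 < ‖1 - z * q‖ := lt_of_lt_of_le (by norm_num) hden
  rw [norm_div, norm_pow, div_le_iff₀ hden_pos]
  nlinarith [pow_nonneg (norm_nonneg q) 3]

/-- If `‖z q‖ ≤ 1/2` then `1 - z q ≠ 0`. [folklore] -/
theorem stub_dirichletSide_den_ne_zero {z q : ℂ} (h : ‖z * q‖ ≤ 1 / 2) : 1 - z * q ≠ 0 := by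
  rw [← norm_pos_iff]
  have := norm_sub_norm_le (1 : ℂ) (z * q)
  rw [norm_one] at this
  linarith

/-- **The tail is holomorphic on a big disc.** If `e^{-δ Re l i} R ≤ 1/2` for all `i ∉ s`, then
`z ↦ Σ_{i ∉ s} T i z` is holomorphic on `|z| < R` (uniform bound `2 w i ‖q_i‖³`, summable). [folklore] -/
theorem stub_dirichletSide_tail_differentiableOn {ι : Type} (w : ι → ℝ) (l : ι → ℂ)
    (hw : ∀ i, 0 < w i)
    (hsum : ∀ t : ℝ, 0 < t → Summable (fun i => w i * Real.exp (-(t * (l i).re))))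
    {δ : ℝ} (hδ : 0 < δ) {R : ℝ} (s : Finset ι)
    (hs : ∀ i, i ∉ s → Real.exp (-(δ * (l i).re)) * R ≤ 1 / 2) :
    DifferentiableOn ℂ (fun z => ∑' i : {i // i ∉ s}, (((w i : ℝ) : ℂ) / 2) *
        (cexp (-((δ : ℂ) * l i)) ^ 3 / (1 - z * cexp (-((δ : ℂ) * l i))) +
          conj (cexp (-((δ : ℂ) * l i))) ^ 3 / (1 - z * conj (cexp (-((δ : ℂ) * l i))))))
      (Metric.ball 0 R) := by
  set q : ι → ℂ := fun i => cexp (-((δ : ℂ) * l i)) with hq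
  have hq_norm : ∀ i, ‖q i‖ = Real.exp (-(δ * (l i).re)) := fun i =>
    stub_dirichletSide_norm_cexp δ (l i)
  have hq3 : ∀ i, ‖q i‖ ^ 3 = Real.exp (-(3 * δ * (l i).re)) := fun i => by
    rw [hq_norm, ← Real.exp_nat_mul]
    congr 1
    push_cast
    ring
  -- the bound `‖z q_i‖ ≤ 1/2` on the ball, for `i ∉ s`
  have hzq : ∀ (i : {i // i ∉ s}) (z : ℂ), z ∈ Metric.ball (0 : ℂ) R → ‖z * q i‖ ≤ 1 / 2 := by
    intro i z hz
    rw [Metric.mem_ball, dist_zero_right] at hz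
    rw [norm_mul, hq_norm]
    calc ‖z‖ * Real.exp (-(δ * (l i).re)) ≤ R * Real.exp (-(δ * (l i).re)) := by
          gcongr
      _ = Real.exp (-(δ * (l i).re)) * R := mul_comm _ _
      _ ≤ 1 / 2 := hs i i.2
  have hzq' : ∀ (i : {i // i ∉ s}) (z : ℂ), z ∈ Metric.ball (0 : ℂ) R → ‖z * conj (q i)‖ ≤ 1 / 2 := by
    intro i z hz
    rw [norm_mul, Complex.norm_conj, ← norm_mul]
    exact hzq i z hz
  refine differentiableOn_tsum_of_summable_norm
    (u := fun i : {i // i ∉ s} => 2 * (w i * Real.exp (-(3 * δ * (l i).re)))) ?_ ?_ Metric.isOpen_ball ?_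
  · exact ((hsum (3 * δ) (by positivity)).subtype _).mul_left 2
  · intro i
    refine DifferentiableOn.mul (differentiableOn_const _) (DifferentiableOn.add ?_ ?_)
    · refine DifferentiableOn.div (differentiableOn_const _) (by fun_prop) fun z hz => ?_
      exact stub_dirichletSide_den_ne_zero (hzq i z hz)
    · refine DifferentiableOn.div (differentiableOn_const _) (by fun_prop) fun z hz => ?_
      exact stub_dirichletSide_den_ne_zero (hzq' i z hz)
  · intro i z hz
    have h1 := stub_dirichletSide_frac_le (hzq i z hz)
    have h2 := stub_dirichletSide_frac_le (hzq' i z hz)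
    rw [Complex.norm_conj] at h2
    have hw2 : ‖(((w i : ℝ) : ℂ) / 2)‖ = w i / 2 := by
      rw [norm_div, Complex.norm_real, Real.norm_of_nonneg (hw i).le]
      norm_num
    rw [norm_mul, hw2, ← hq3]
    calc w i / 2 * ‖q i ^ 3 / (1 - z * q i) + conj (q i) ^ 3 / (1 - z * conj (q i))‖
        ≤ w i / 2 * (2 * ‖q i‖ ^ 3 + 2 * ‖q i‖ ^ 3) := by
          gcongr
          · exact div_nonneg (hw i).le (by norm_num)
          · exact (norm_add_le _ _).trans (add_le_add h1 h2)
      _ = 2 * (w i * ‖q i‖ ^ 3) := by ring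


/-- **Stub `stub_dirichletSide`** (registered signature): the Dirichlet side of the engine — for
`‖z‖ < 1`, `δ > 0`, the family `i ↦ (w i/2)(q_i³/(1 - z q_i) + q̄_i³/(1 - z q̄_i))`, `q_i = e^{-δ l i}`, is
summable and the power series `Σ_k z^k f((k+3)δ)` of the samples of `f t = Re Σ_i w i e^{-t l i}` sums
to its sum. [folklore] -/
theorem stub_dirichletSide :
    ∀ (ι : Type) [Countable ι] (w : ι → ℝ) (l : ι → ℂ),
      (∀ i, 0 < w i) → (∀ i, 0 < (l i).re) →
      (∀ t : ℝ, 0 < t → Summable (fun i => w i * Real.exp (-(t * (l i).re)))) →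
      ∀ (δ : ℝ), 0 < δ → ∀ (z : ℂ), ‖z‖ < 1 →
        Summable (fun i => (((w i : ℝ) : ℂ) / 2) *
            (cexp (-((δ : ℂ) * l i)) ^ 3 / (1 - z * cexp (-((δ : ℂ) * l i))) +
              conj (cexp (-((δ : ℂ) * l i))) ^ 3 / (1 - z * conj (cexp (-((δ : ℂ) * l i)))))) ∧
        HasSum (fun k : ℕ => z ^ k *
            (((∑' i, ((w i : ℝ) : ℂ) * cexp (-(((((k : ℝ) + 3) * δ : ℝ) : ℂ) * l i))).re : ℝ) : ℂ))
          (∑' i, (((w i : ℝ) : ℂ) / 2) *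
            (cexp (-((δ : ℂ) * l i)) ^ 3 / (1 - z * cexp (-((δ : ℂ) * l i))) +
              conj (cexp (-((δ : ℂ) * l i))) ^ 3 / (1 - z * conj (cexp (-((δ : ℂ) * l i)))))) := by
  intro ι _ w l hw hl hsum δ hδ z hz
  exact stub_dirichletSide_dirichlet_hasSum w l hw hl hsum hδ hz

end Summit.RiemannHypothesis.RiemannHypothesis.Theorems.RuelleBandExactFirstBand

end
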